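import Summits.QuantumFields.GaugeBoot.StrongCouplingReadMany
import Summits.QuantumFields.GaugeBoot.StrongCouplingWilsonLoops
import HarnessLib

/-!
# Strong coupling from the loop equation: the boundary links of a rectangle and separated links in coordinates (gauge-boot, ADDENDUM 26 part B)

HONEST FRAMING (cell `pub-gaugeboot`, page 1 of every file): the venture produces certified bounds
on lattice expectations at stated coupling, gauge group, dimension and torus size; NOT a mass gap,
NOT a continuum limit, NOT a string tension; NOT Yang–Mills-summit-bearing (barriers
`FixedCouplingUltralocality`, `PerturbativeInvisibility`).  Pure word combinatorics on the torus `(ℤ/L)^d`; no number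
of the cell's tables is touched.

## Content

Bookkeeping for the all-order strong-coupling decay of Wilson loops (`StrongCouplingWilsonLoopDecay`), which applies the
read-many bound of `StrongCouplingReadMany` to the rectangle word `(+e_i)^R (+e_j)^T (−e_i)^R (−e_j)^T`:

* `edgesRead_line`, `edgesRead_replicate_bwd`, `edgesRead_rectangle` — the `2(R+T)` boundary links explicitly;
  ★ `nodup_edgesRead_rectangle` — they are pairwise distinct for `i ≠ j`, `1 ≤ R < L`, `1 ≤ T < L` (so each is read
  exactly once); the bottom / right / top / left links as members of the list;
* separated links (`StrongCoupling.Separated`: no plaquette through the first contains the second) in coordinates: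
  `separated_of_forall_ne`, `separated_of_apply_eq` (same direction, on the axis), `separated_of_apply_sub` (same
  direction, a transverse coordinate differing by `∉ {0, ±1}`), `separated_of_ne_of_apply_sub` (different directions).

Everything is `[folklore]`.
-/

noncomputable section

open MeasureTheory Filter Topology NormedSpace
open scoped Matrix.Norms.Frobenius Matrix
open Literature.MathematicalPhysics.QuantumFieldTheory Literature.MathematicalPhysics.QuantumLattice
open Summit.QuantumFields.YangMills.Cruxes.CurvatureAmnesia.WardDefect.SchwingerDyson

namespace Summit.QuantumFields.GaugeBoot

namespace StrongCoupling

variable {d L N : ℕ}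

/-! ## The boundary links of a rectangle -/

section Edges

/-- Links of the straight segment `(+e_k)^n` from `y`: `(y + m e_k, k)`, `m < n`. [folklore] -/
theorem edgesRead_line (k : Fin d) : ∀ (n : ℕ) (y : Site d L),
    Word.edgesRead y (Word.line k n) = (List.range n).map fun m => (y + Pi.single k ((m : ℕ) : ZMod L), k)
  | 0, y => by simp
  | n + 1, y => by
    rw [Word.line_succ, Word.edgesRead_cons, edgesRead_line k n, List.range_succ_eq_map, List.map_cons, List.map_map]
    simp only [Step.edge_fwd, Step.apply_fwd, Nat.cast_zero, Pi.single_zero, add_zero]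
    congr 1
    refine List.map_congr_left fun m _ => ?_
    simp only [Function.comp_apply, Site.shift, Nat.cast_succ, Pi.single_add]
    abel_nf

/-- Links of the straight backward segment `(−e_k)^n` from `y`: `(y − (m+1) e_k, k)`, `m < n`. [folklore] -/
theorem edgesRead_replicate_bwd (k : Fin d) : ∀ (n : ℕ) (y : Site d L),
    Word.edgesRead y (List.replicate n (.bwd k)) = (List.range n).map fun m => (y - Pi.single k (((m + 1 : ℕ) : ℕ) : ZMod L), k)
  | 0, y => by simp
  | n + 1, y => by
    rw [List.replicate_succ, Word.edgesRead_cons, edgesRead_replicate_bwd k n, List.range_succ_eq_map, List.map_cons,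
      List.map_map]
    simp only [Step.edge_bwd, Step.apply_bwd, zero_add, Nat.cast_one]
    congr 1
    refine List.map_congr_left fun m _ => ?_
    simp only [Function.comp_apply, Nat.cast_succ, Pi.single_add]
    abel_nf

/-- Endpoint of `(−e_k)^n`: `y − n e_k`. [folklore] -/
theorem endpoint_replicate_bwd (k : Fin d) : ∀ (n : ℕ) (y : Site d L),
    Word.endpoint y (List.replicate n (.bwd k)) = y - Pi.single k ((n : ℕ) : ZMod L)
  | 0, y => by simp
  | n + 1, y => by
    rw [List.replicate_succ, Word.endpoint_cons, endpoint_replicate_bwd k n]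
    simp only [Step.apply_bwd, Nat.cast_succ, Pi.single_add]
    abel

/-- ★ **The links of the rectangle word**: bottom `(+e_i)^R` from `x`, right `(+e_j)^T` from `x + R e_i`, top `(−e_i)^R`
from `x + R e_i + T e_j`, left `(−e_j)^T` from `x + T e_j`. [folklore] -/
theorem edgesRead_rectangle (x : Site d L) (i j : Fin d) (R T : ℕ) :
    Word.edgesRead x (Word.rectangle i j R T) =
      Word.edgesRead x (Word.line i R) ++ Word.edgesRead (x + Pi.single i ((R : ℕ) : ZMod L)) (Word.line j T) ++
        Word.edgesRead (x + Pi.single i ((R : ℕ) : ZMod L) + Pi.single j ((T : ℕ) : ZMod L)) (List.replicate R (.bwd i)) ++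
        Word.edgesRead (x + Pi.single j ((T : ℕ) : ZMod L)) (List.replicate T (.bwd j)) := by
  have h3 : x + Pi.single i ((R : ℕ) : ZMod L) + Pi.single j ((T : ℕ) : ZMod L) - Pi.single i ((R : ℕ) : ZMod L) =
      x + Pi.single j ((T : ℕ) : ZMod L) := by abel
  simp only [Word.rectangle, Word.edgesRead_append, Word.endpoint_append, Word.endpoint_line, endpoint_replicate_bwd, h3]

/-- In `ℤ/L`: `m ↦ (m : ℤ/L)` is injective below `L`. [folklore] -/
theorem natCast_zmod_inj {m m' : ℕ} (hm : m < L) (hm' : m' < L) (h : ((m : ℕ) : ZMod L) = (m' : ℕ)) : m = m' := by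
  rw [ZMod.natCast_eq_natCast_iff', Nat.mod_eq_of_lt hm, Nat.mod_eq_of_lt hm'] at h
  exact h

/-- In `ℤ/L`: distinct naturals below `L` have distinct casts. [folklore] -/
theorem natCast_zmod_ne {m m' : ℕ} (hm : m < L) (hm' : m' < L) (h : m ≠ m') : ((m : ℕ) : ZMod L) ≠ (m' : ℕ) :=
  fun e => h (natCast_zmod_inj hm hm' e)

/-- The `n ≤ L` links of a straight segment are distinct. [folklore] -/
theorem nodup_edgesRead_line (k : Fin d) {n : ℕ} (hn : n ≤ L) (y : Site d L) : (Word.edgesRead y (Word.line k n)).Nodup := by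
  rw [edgesRead_line]
  refine List.Nodup.map_on (fun m hm m' hm' h => ?_) (List.nodup_range)
  rw [List.mem_range] at hm hm'
  have h1 := congrArg (fun e : Edge d L => e.1 k) h
  simp only [Pi.add_apply, Pi.single_eq_same, add_right_inj] at h1
  exact natCast_zmod_inj (by omega) (by omega) h1

/-- The `n ≤ L` links of a straight backward segment are distinct. [folklore] -/
theorem nodup_edgesRead_replicate_bwd (k : Fin d) {n : ℕ} (hn : n ≤ L) (y : Site d L) :
    (Word.edgesRead y (List.replicate n (.bwd k))).Nodup := by
  rw [edgesRead_replicate_bwd]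
  refine List.Nodup.map_on (fun m hm m' hm' h => ?_) (List.nodup_range)
  rw [List.mem_range] at hm hm'
  have h1 := congrArg (fun e : Edge d L => e.1 k) h
  simp only [Pi.sub_apply, Pi.single_eq_same, sub_right_inj, Nat.cast_succ, add_left_inj] at h1
  exact natCast_zmod_inj (by omega) (by omega) h1

/-- A link of `(+e_k)^n` from `y`: direction `k`, all coordinates but `k` those of `y`. [folklore] -/
theorem eq_of_mem_edgesRead_line {k : Fin d} {n : ℕ} {y : Site d L} {e : Edge d L} (he : e ∈ Word.edgesRead y (Word.line k n)) :
    e.2 = k ∧ ∀ c, c ≠ k → e.1 c = y c := by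
  rw [edgesRead_line, List.mem_map] at he
  obtain ⟨m, _, rfl⟩ := he
  exact ⟨rfl, fun c hc => by simp [Pi.single_eq_of_ne hc]⟩

/-- A link of `(−e_k)^n` from `y`: direction `k`, all coordinates but `k` those of `y`. [folklore] -/
theorem eq_of_mem_edgesRead_replicate_bwd {k : Fin d} {n : ℕ} {y : Site d L} {e : Edge d L}
    (he : e ∈ Word.edgesRead y (List.replicate n (.bwd k))) : e.2 = k ∧ ∀ c, c ≠ k → e.1 c = y c := by
  rw [edgesRead_replicate_bwd, List.mem_map] at he
  obtain ⟨m, _, rfl⟩ := he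
  exact ⟨rfl, fun c hc => by simp [Pi.single_eq_of_ne hc]⟩

/-- ★ **The `2(R+T)` boundary links of the rectangle are distinct** (`i ≠ j`, `1 ≤ R < L`, `1 ≤ T < L`). [folklore] -/
theorem nodup_edgesRead_rectangle [NeZero L] (x : Site d L) {i j : Fin d} (hij : i ≠ j) {R T : ℕ} (hR1 : 1 ≤ R) (hR : R < L)
    (hT1 : 1 ≤ T) (hT : T < L) : (Word.edgesRead x (Word.rectangle i j R T)).Nodup := by
  have hji : j ≠ i := fun h => hij h.symm
  have hR0 : ((R : ℕ) : ZMod L) ≠ 0 := natCast_zmod_ne_zero hR1 hR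
  have hT0 : ((T : ℕ) : ZMod L) ≠ 0 := natCast_zmod_ne_zero hT1 hT
  rw [edgesRead_rectangle]
  -- coordinates of the four sides: bottom `(i; c_j = x_j)`, right `(j; c_i = x_i + R)`, top `(i; c_j = x_j + T)`,
  -- left `(j; c_i = x_i)`
  have hB : ∀ e ∈ Word.edgesRead x (Word.line i R), e.2 = i ∧ e.1 j = x j := fun e he =>
    ⟨(eq_of_mem_edgesRead_line he).1, (eq_of_mem_edgesRead_line he).2 j hji⟩
  have hRt : ∀ e ∈ Word.edgesRead (x + Pi.single i ((R : ℕ) : ZMod L)) (Word.line j T),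
      e.2 = j ∧ e.1 i = x i + ((R : ℕ) : ZMod L) := fun e he =>
    ⟨(eq_of_mem_edgesRead_line he).1, by rw [(eq_of_mem_edgesRead_line he).2 i hij]; simp⟩
  have hTp : ∀ e ∈ Word.edgesRead (x + Pi.single i ((R : ℕ) : ZMod L) + Pi.single j ((T : ℕ) : ZMod L)) (List.replicate R (.bwd i)),
      e.2 = i ∧ e.1 j = x j + ((T : ℕ) : ZMod L) := fun e he =>
    ⟨(eq_of_mem_edgesRead_replicate_bwd he).1, by
      rw [(eq_of_mem_edgesRead_replicate_bwd he).2 j hji]; simp [Pi.single_eq_of_ne hji]⟩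
  have hLf : ∀ e ∈ Word.edgesRead (x + Pi.single j ((T : ℕ) : ZMod L)) (List.replicate T (.bwd j)),
      e.2 = j ∧ e.1 i = x i := fun e he =>
    ⟨(eq_of_mem_edgesRead_replicate_bwd he).1, by
      rw [(eq_of_mem_edgesRead_replicate_bwd he).2 i hij]; simp [Pi.single_eq_of_ne hij]⟩
  refine List.nodup_append.2 ⟨List.nodup_append.2 ⟨List.nodup_append.2 ⟨nodup_edgesRead_line i hR.le x,
    nodup_edgesRead_line j hT.le _, fun a ha b hb hab => ?_⟩, nodup_edgesRead_replicate_bwd i hR.le _, fun a ha b hb hab => ?_⟩,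
    nodup_edgesRead_replicate_bwd j hT.le _, fun a ha b hb hab => ?_⟩
  · exact hij (by rw [← (hB a ha).1, ← (hRt b hb).1, hab])
  · rcases List.mem_append.1 ha with ha | ha
    · have h := (hB a ha).2; rw [hab, (hTp b hb).2] at h
      exact hT0 (by simpa using h)
    · exact hji (by rw [← (hRt a ha).1, ← (hTp b hb).1, hab])
  · rcases List.mem_append.1 ha with ha | ha
    · rcases List.mem_append.1 ha with ha | ha
      · exact hij (by rw [← (hB a ha).1, ← (hLf b hb).1, hab])
      · have h := (hRt a ha).2; rw [hab, (hLf b hb).2] at h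
        exact hR0 (by simpa using h.symm)
    · exact hij (by rw [← (hTp a ha).1, ← (hLf b hb).1, hab])

/-- The bottom link `(x + k e_i, i)` (`k < R`) is a link of the rectangle. [folklore] -/
theorem bottom_mem_edgesRead_rectangle (x : Site d L) (i j : Fin d) {R k : ℕ} (hk : k < R) (T : ℕ) :
    (x + Pi.single i ((k : ℕ) : ZMod L), i) ∈ Word.edgesRead x (Word.rectangle i j R T) := by
  rw [edgesRead_rectangle, List.append_assoc, List.append_assoc]
  refine List.mem_append_left _ ?_
  rw [edgesRead_line, List.mem_map]
  exact ⟨k, List.mem_range.2 hk, rfl⟩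

/-- The right link `(x + R e_i + m e_j, j)` (`m < T`) is a link of the rectangle. [folklore] -/
theorem right_mem_edgesRead_rectangle (x : Site d L) (i j : Fin d) (R : ℕ) {T m : ℕ} (hm : m < T) :
    (x + Pi.single i ((R : ℕ) : ZMod L) + Pi.single j ((m : ℕ) : ZMod L), j) ∈ Word.edgesRead x (Word.rectangle i j R T) := by
  rw [edgesRead_rectangle, List.append_assoc, List.append_assoc]
  refine List.mem_append_right _ (List.mem_append_left _ ?_)
  rw [edgesRead_line, List.mem_map]
  exact ⟨m, List.mem_range.2 hm, rfl⟩

/-- The top link `(x + k e_i + T e_j, i)` (`k < R`) is a link of the rectangle. [folklore] -/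
theorem top_mem_edgesRead_rectangle (x : Site d L) (i j : Fin d) {R k : ℕ} (hk : k < R) (T : ℕ) :
    (x + Pi.single i ((k : ℕ) : ZMod L) + Pi.single j ((T : ℕ) : ZMod L), i) ∈ Word.edgesRead x (Word.rectangle i j R T) := by
  rw [edgesRead_rectangle, List.append_assoc, List.append_assoc]
  refine List.mem_append_right _ (List.mem_append_right _ (List.mem_append_left _ ?_))
  rw [edgesRead_replicate_bwd, List.mem_map]
  refine ⟨R - 1 - k, List.mem_range.2 (by omega), ?_⟩
  have hc : ((R : ℕ) : ZMod L) - (((R - 1 - k + 1 : ℕ) : ℕ) : ZMod L) = ((k : ℕ) : ZMod L) := by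
    rw [show R - 1 - k + 1 = R - k by omega, Nat.cast_sub hk.le]; ring
  simp only [Prod.mk.injEq, and_true]
  rw [← hc, Pi.single_sub]
  abel

/-- The left link `(x + m e_j, j)` (`m < T`) is a link of the rectangle. [folklore] -/
theorem left_mem_edgesRead_rectangle (x : Site d L) (i j : Fin d) (R : ℕ) {T m : ℕ} (hm : m < T) :
    (x + Pi.single j ((m : ℕ) : ZMod L), j) ∈ Word.edgesRead x (Word.rectangle i j R T) := by
  rw [edgesRead_rectangle]
  refine List.mem_append_right _ ?_
  rw [edgesRead_replicate_bwd, List.mem_map]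
  refine ⟨T - 1 - m, List.mem_range.2 (by omega), ?_⟩
  have hc : ((T : ℕ) : ZMod L) - (((T - 1 - m + 1 : ℕ) : ℕ) : ZMod L) = ((m : ℕ) : ZMod L) := by
    rw [show T - 1 - m + 1 = T - m by omega, Nat.cast_sub hm.le]; ring
  simp only [Prod.mk.injEq, and_true]
  rw [← hc, Pi.single_sub]
  abel

end Edges

/-! ## Separated links, in coordinates -/

section SeparatedCoords

/-- **Same direction**: the `μ`-links on the plaquettes through `(y, μ)` are `(y, μ)` and `(y ± e_ν, μ)`, `ν ≠ μ`; a link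
`(y', μ)` avoiding these sites is separated from `(y, μ)`. [folklore] -/
theorem separated_of_forall_ne {y y' : Site d L} {μ : Fin d} (h0 : y' ≠ y)
    (h1 : ∀ ν, ν ≠ μ → y' ≠ y.shift ν ∧ y' ≠ y - Pi.single ν 1) : Separated (y, μ) (y', μ) := by
  intro ν hν ε hmem
  dsimp only at hν hmem
  cases ε with
  | true =>
    rw [edgesRead_plaqWord_true] at hmem
    simp only [List.mem_cons, List.mem_nil_iff, or_false, Prod.mk.injEq] at hmem
    rcases hmem with ⟨h, _⟩ | ⟨_, h⟩ | ⟨h, _⟩ | ⟨_, h⟩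
    · exact h0 h
    · exact hν h.symm
    · exact (h1 ν hν).1 h
    · exact hν h.symm
  | false =>
    rw [edgesRead_plaqWord_false] at hmem
    simp only [List.mem_cons, List.mem_nil_iff, or_false, Prod.mk.injEq] at hmem
    rcases hmem with ⟨h, _⟩ | ⟨_, h⟩ | ⟨h, _⟩ | ⟨_, h⟩
    · exact h0 h
    · exact hν h.symm
    · exact (h1 ν hν).2 h
    · exact hν h.symm

/-- **Same direction, on the axis**: `(y', μ)` with `y' ≠ y` agreeing with `y` off the coordinate `μ` is separated from
`(y, μ)` (`L ≥ 2`). [folklore] -/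
theorem separated_of_apply_eq {y y' : Site d L} {μ : Fin d} (hL : (1 : ZMod L) ≠ 0) (h0 : y' ≠ y)
    (h : ∀ c, c ≠ μ → y' c = y c) : Separated (y, μ) (y', μ) := by
  refine separated_of_forall_ne h0 fun ν hν => ⟨fun e => hL ?_, fun e => hL ?_⟩
  · have h1 := h ν hν
    rw [e] at h1
    simpa [Site.shift] using h1
  · have h1 := h ν hν
    rw [e] at h1
    simp only [Pi.sub_apply, Pi.single_eq_same, sub_eq_self] at h1
    exact h1

/-- **Same direction, off the axis**: if for some coordinate `c ≠ μ` the difference `y'_c − y_c` is none of `0, 1, −1`,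
then `(y', μ)` is separated from `(y, μ)`. [folklore] -/
theorem separated_of_apply_sub {y y' : Site d L} {μ c : Fin d} (hc : c ≠ μ) (h0 : y' c - y c ≠ 0) (h1 : y' c - y c ≠ 1)
    (h2 : y' c - y c ≠ -1) : Separated (y, μ) (y', μ) := by
  refine separated_of_forall_ne (fun e => h0 (by rw [e, sub_self])) fun ν _ => ⟨fun e => ?_, fun e => ?_⟩
  · by_cases hνc : ν = c
    · subst hνc; exact h1 (by rw [e]; simp [Site.shift])
    · exact h0 (by rw [e]; simp [Site.shift, Pi.single_eq_of_ne (Ne.symm hνc)])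
  · by_cases hνc : ν = c
    · subst hνc; exact h2 (by rw [e]; simp)
    · exact h0 (by rw [e]; simp [Pi.single_eq_of_ne (Ne.symm hνc)])

/-- **Different directions**: the `μ'`-links (`μ' ≠ μ`) on the plaquettes through `(y, μ)` are `(y, μ')`, `(y + e_μ, μ')`,
`(y + e_μ − e_μ', μ')`, `(y − e_μ', μ')`; if `y'_{μ'} − y_{μ'}` is neither `0` nor `−1`, then `(y', μ')` is separated from
`(y, μ)`. [folklore] -/
theorem separated_of_ne_of_apply_sub {y y' : Site d L} {μ μ' : Fin d} (hμ : μ' ≠ μ) (h0 : y' μ' - y μ' ≠ 0)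
    (h1 : y' μ' - y μ' ≠ -1) : Separated (y, μ) (y', μ') := by
  intro ν hν ε hmem
  dsimp only at hν hmem
  cases ε with
  | true =>
    rw [edgesRead_plaqWord_true] at hmem
    simp only [List.mem_cons, List.mem_nil_iff, or_false, Prod.mk.injEq] at hmem
    rcases hmem with ⟨_, h⟩ | ⟨h, rfl⟩ | ⟨_, h⟩ | ⟨h, rfl⟩
    · exact hμ h
    · exact h0 (by rw [h]; simp [Site.shift, Pi.single_eq_of_ne hμ])
    · exact hμ h
    · exact h0 (by rw [h, sub_self])
  | false =>
    rw [edgesRead_plaqWord_false] at hmem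
    simp only [List.mem_cons, List.mem_nil_iff, or_false, Prod.mk.injEq] at hmem
    rcases hmem with ⟨_, h⟩ | ⟨h, rfl⟩ | ⟨_, h⟩ | ⟨h, rfl⟩
    · exact hμ h
    · exact h1 (by rw [h]; simp [Site.shift, Pi.single_eq_of_ne hμ])
    · exact hμ h
    · exact h1 (by rw [h]; simp)

end SeparatedCoords

end StrongCoupling

end Summit.QuantumFields.GaugeBoot

end
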